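import Summits.QuantumFields.BalabanUV.T4Continuum.Support.NE7SquaredBumpNestedFix
import Summits.QuantumFields.BalabanUV.T4Continuum.Support.NE3TentBumpSharp

/-!
# NE7SquaredBumpGradient — THE `ℓ²` COVARIANT GRADIENT OF THE SQUARED-TENT NESTED-MEAN FIX: `‖D_W(sfixW θ′)(y, α)‖ ≤ (2∕M + κ_a)·(2∕tentMean2)·‖θ′(blk y)‖`
# bondwise, hence `Σ_{periodBox(M·N)} Σ_α ‖D_W(sfixW θ′)‖² ≤ d·M^d·((2∕M + κ_a)·(2∕tentMean2))²·Σ_{periodBox N} ‖θ′‖²` — the one-derivative gain `1∕M` of the exact right inverse of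
# `bmeanIterW` that the divergence rigidity (DIV) of the orbit comparison needs (file 149 of the curved (APE), F220)

Cell `pub-balaban`, rung (B)+1 sub-cell t4, lineage `b2b-balaban-t4-ne7-p1` (CRUX PROVER NE7 #1 = OWNER of row NE7), generation 86; memo
`t4/b2b-balaban-t4-ne7-p1-g86/ORBIT-COMPARISON.md` §2.  The squared-profile TWIN of row NE3's `NE3TentBumpSharp.norm_gaugeDir_dressW_bump_le_sharp` (in-block ∕ far-face split),
over g84's F185 `NE7SquaredBumpNestedFix` (`sfixW`, `norm_sfixCoef_le`), `NE3SquaredTentBump.norm_dPot_bump2_le` (flat coboundary `≤ (2∕M)·‖c‖`, faces included),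
`NE3SquaredTentProfile.tentSq_le_of_res_eq` and `NE3DressedBlockField.norm_gaugeDir_dressW_inblock_le` (the comb transport defect `κ_a = 2(d−1)(M−1)a`) BY NAME.
WHY.  The orbit comparison of gen 86 (T_A vs row NE3's T_♮ through the `N(Q′(W))`-orbits of `ker Q̄_W`) needs the rigidity of `N(Q′(W))^⊥`: a 1-form whose covariant divergence is
`hsR`-orthogonal to `N(Q′(W))` has divergence `O(‖·‖∕M)` in `ℓ²` — by duality against a right inverse of the nested mean with ONE-DERIVATIVE gain `1∕M` in `ℓ²`.  g84 built the right
inverse (`sfixW`, exact, sup `2·64^d`) and its covariant Laplacian (`1∕M²`, sup); THIS file supplies the `ℓ²` gradient.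
WHAT ([folklore]; 0 def, 0 sorry).  §1 **`norm_gaugeDir_dressW_bump2_le`** (`W` unitary, `SmallField W a`, `M ≥ 1`): `‖gaugeDir W (dressW M W (bump2 M c)) (M•z + v) α‖ ≤ (2∕M + κ_a)·‖c z‖`,
and its block-summed square `sum_normSq_gaugeDir_dressW_bump2_le`: `Σ_{periodBox(M·N)} Σ_α ‖…‖² ≤ d·M^d·(2∕M + κ_a)²·Σ_{periodBox N} ‖c‖²`; §2 the same for `sfixW θ′` with the extra factor
`(2∕tentMean2)²` (`≤ (2·64^d)²`): **`sum_normSq_gaugeDir_sfixW_le`**.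
HONEST FRAMING (page 1): elementary lattice calculus of OUR bump at one unitary small-field background; nothing of Bałaban's asserted; (DIV), (H1), (P_a), (APE) on curved data NOT
proved here; NOT ONE-STEP, NOT NE7; spine 0∕9; finite T⁴ rung (B)+1 — NOT infinite volume, NOT mass gap, NOT `BetaPertH`, NOT Clay.  Continuum YM on T⁴ ⇐ BetaPertH ∧ nine spine
estimates (0/9 proved); BetaPertH ⇐ (D1) ∧ (D4) ∧ CAP+tail; G-an2-4 gates asym, D1 and NE2/3/4.
-/

set_option autoImplicit false

open scoped BigOperators Matrix.Norms.L2Operator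
open Finset

namespace Summit.QuantumFields.BalabanUV.T4Continuum.NE7SquaredBumpGradient

open Literature.MathematicalPhysics.QuantumFieldTheory.Balaban1983to89
open B7Prop1Explicit B7Prop2Explicit
open T4AveragingDeficitWall (IsUnitaryCfg SmallField Ad)
open T4AveragingDeficitWallBoundary (periodBox mem_periodBox card_periodBox)
open AveragingDeficitTransport (norm_Ad_of_unitary)
open AveragingDeficitBlockDensity (btree btree_mem)
open AveragingDeficitMultiLevelPrep (LevelSmall)
open AveragingDeficitTwoLevelPrep (prop1Radius)
open SpreadLift (loopRad)
open BlockAveragePushDirGauge (gaugeDir)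
open SmoothRefineBlocks (blk res res_add_e_self blk_res_eq_of)
open NE3BlockLineAverage (sum_periodBox_blocks)
open NE3TangentNoGoWords (dPot)
open NE3CoarseInterpolant (blk_block)
open NE3TentBump (tent tent_nonneg tent_le_one tent_eq_zero_of_res_eq_zero)
open NE3SquaredTentBump (bump2 bump2_of_res_eq_zero norm_dPot_bump2_le)
open NE3SquaredTentProfile (tentSq_le_of_res_eq)
open NE3DressedBlockField (dressW cdiv_block norm_gaugeDir_dressW_inblock_le)
open NE7SquaredBumpNestedMeanOperator (tentMean2 tentMean2_pos inv_le_tentMean2)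
open NE7SquaredBumpNestedFix (sfixCoef sfixW norm_sfixCoef_le)

noncomputable section

variable {d : ℕ} {n : Type*} [Fintype n] [DecidableEq n] [Nonempty n]

/-! ## §1 The covariant gradient of a dressed squared-tent bump -/

/-- **BONDWISE**: `W` unitary, `SmallField W a`, `0 ≤ a`, `M ≥ 1`, `v ∈ [0,M)^d`:
`‖gaugeDir W (dressW M W (bump2 M c)) (M•z + v) α‖ ≤ (2∕M + 2(d−1)(M−1)a)·‖c z‖` — far face: the arriving bump vanishes and `tent² ≤ 1∕M² ≤ 2∕M`; in-block: flat coboundary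
`≤ 2∕M` (row NE3) plus the comb transport defect `κ_a·tent²·‖c z‖ ≤ κ_a‖c z‖`. [folklore] -/
theorem norm_gaugeDir_dressW_bump2_le {M : ℕ} (hM : 1 ≤ M) {W : Site d → Fin d → (Matrix n n ℂ)ˣ} (hW : IsUnitaryCfg W)
    {a : ℝ} (ha : 0 ≤ a) (hWa : SmallField W a) (c : Site d → Matrix n n ℂ) (z : Site d) {v : Site d}
    (hv : v ∈ periodBox (d := d) M) (α : Fin d) :
    ‖gaugeDir W (dressW M W (bump2 M c)) ((M : ℤ) • z + v) α‖
      ≤ (2 / (M : ℝ) + 2 * (((d : ℝ) - 1) * ((M : ℝ) - 1) * a)) * ‖c z‖ := by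
  have hM0 : (0 : ℝ) < M := by exact_mod_cast (by omega : 0 < M)
  have hd1 : (1 : ℝ) ≤ d := by exact_mod_cast Fin.pos α
  have hM1 : (1 : ℝ) ≤ M := by exact_mod_cast hM
  have hK0 : 0 ≤ ((d : ℝ) - 1) * ((M : ℝ) - 1) * a := mul_nonneg (mul_nonneg (by linarith) (by linarith)) ha
  set y : Site d := (M : ℤ) • z + v with hy
  have hvi := fun i => (mem_periodBox.1 hv i)
  obtain ⟨hblk, hres⟩ := blk_res_eq_of (L := M) hM hy.symm (fun i => (hvi i).1) (fun i => (hvi i).2)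
  have hcd : SkeletonLattice.cdiv M y = z := by rw [hy]; exact cdiv_block z hv
  have ht0 := tent_nonneg hM y
  have ht1 := tent_le_one hM y
  have hbumpy : ‖bump2 M c y‖ = tent M y ^ 2 * ‖c z‖ := by
    unfold bump2; rw [norm_smul, Real.norm_of_nonneg (sq_nonneg _), hblk]
  have hc0 := norm_nonneg (c z)
  by_cases hface : v α = (M : ℤ) - 1
  · -- the far face: the bump at `y + e α` vanishes
    have hry : res M y α = (M : ℤ) - 1 := by rw [hres]; exact hface
    have hr0 : res M (y + e α) α = 0 := by rw [res_add_e_self hM, if_pos hry]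
    have hzero : bump2 M c (y + e α) = 0 := bump2_of_res_eq_zero M c hr0
    have hgd : gaugeDir W (dressW M W (bump2 M c)) y α = Ad (W y α)⁻¹ (dressW M W (bump2 M c) y) := by
      simp only [gaugeDir, dressW, hzero, AveragingDeficitNearIdentity.Ad_zero, sub_zero]
    rw [hgd, norm_Ad_of_unitary ((unitaryUnits _).inv_mem (hW y α)), dressW,
      norm_Ad_of_unitary ((unitaryUnits _).inv_mem (btree_mem hW M _ _)), hbumpy]
    have hsq : tent M y ^ 2 ≤ 2 / (M : ℝ) := by
      refine (tentSq_le_of_res_eq hM hry).trans ?_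
      rw [div_le_div_iff₀ (by positivity) hM0]
      nlinarith
    have h2 : tent M y ^ 2 ≤ 2 / (M : ℝ) + 2 * (((d : ℝ) - 1) * ((M : ℝ) - 1) * a) := by linarith
    exact mul_le_mul_of_nonneg_right h2 hc0
  · -- inside the block: both ends in block `z`
    have hvα : v α + 1 < M := by
      have := (hvi α).2; omega
    have hv' : v + e α ∈ periodBox (d := d) M := by
      rw [mem_periodBox]; intro i
      by_cases hi : i = α
      · subst hi; simp only [Pi.add_apply, B8Lemma1NonAbelian.e_apply_self]; exact ⟨by linarith [(hvi i).1], hvα⟩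
      · simp only [Pi.add_apply, B8Lemma1NonAbelian.e_apply_of_ne hi, add_zero]; exact hvi i
    have hcd' : SkeletonLattice.cdiv M (y + e α) = SkeletonLattice.cdiv M y := by
      rw [hcd, hy, add_assoc]; exact cdiv_block z hv'
    refine (norm_gaugeDir_dressW_inblock_le hM hW ha hWa (bump2 M c) hcd').trans ?_
    have h1 : ‖dPot (bump2 M c) y α‖ ≤ 2 / (M : ℝ) * ‖c z‖ := by
      have h := norm_dPot_bump2_le hM c y α
      rwa [hblk] at h
    have h2 : 2 * (((d : ℝ) - 1) * ((M : ℝ) - 1) * a) * ‖bump2 M c y‖ ≤ 2 * (((d : ℝ) - 1) * ((M : ℝ) - 1) * a) * ‖c z‖ := by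
      rw [hbumpy]
      have : tent M y ^ 2 * ‖c z‖ ≤ 1 * ‖c z‖ := by gcongr; exact pow_le_one₀ ht0 ht1
      rw [one_mul] at this
      exact mul_le_mul_of_nonneg_left this (by positivity)
    calc ‖dPot (bump2 M c) y α‖ + 2 * (((d : ℝ) - 1) * ((M : ℝ) - 1) * a) * ‖bump2 M c y‖
        ≤ 2 / (M : ℝ) * ‖c z‖ + 2 * (((d : ℝ) - 1) * ((M : ℝ) - 1) * a) * ‖c z‖ := add_le_add h1 h2
      _ = (2 / (M : ℝ) + 2 * (((d : ℝ) - 1) * ((M : ℝ) - 1) * a)) * ‖c z‖ := by ring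

/-- **SUMMED OVER THE TORUS OF SIDE `M·N`**: `Σ_{y∈periodBox(M·N)} Σ_α ‖gaugeDir W (dressW M W (bump2 M c)) y α‖² ≤ d·M^d·(2∕M + κ_a)²·Σ_{z∈periodBox N} ‖c z‖²`. [folklore] -/
theorem sum_normSq_gaugeDir_dressW_bump2_le {M : ℕ} (hM : 1 ≤ M) (N : ℕ) {W : Site d → Fin d → (Matrix n n ℂ)ˣ} (hW : IsUnitaryCfg W)
    {a : ℝ} (ha : 0 ≤ a) (hWa : SmallField W a) (c : Site d → Matrix n n ℂ) :
    ∑ y ∈ periodBox (d := d) (M * N), ∑ α : Fin d, ‖gaugeDir W (dressW M W (bump2 M c)) y α‖ ^ 2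
      ≤ (d : ℝ) * (M : ℝ) ^ d * (2 / (M : ℝ) + 2 * (((d : ℝ) - 1) * ((M : ℝ) - 1) * a)) ^ 2 * ∑ z ∈ periodBox (d := d) N, ‖c z‖ ^ 2 := by
  set K : ℝ := 2 / (M : ℝ) + 2 * (((d : ℝ) - 1) * ((M : ℝ) - 1) * a) with hK
  have hpt : ∀ (z : Site d) {v : Site d}, v ∈ periodBox (d := d) M → ∀ α : Fin d,
      ‖gaugeDir W (dressW M W (bump2 M c)) ((M : ℤ) • z + v) α‖ ^ 2 ≤ K ^ 2 * ‖c z‖ ^ 2 := by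
    intro z v hv α
    have h := norm_gaugeDir_dressW_bump2_le hM hW ha hWa c z hv α
    calc ‖gaugeDir W (dressW M W (bump2 M c)) ((M : ℤ) • z + v) α‖ ^ 2 ≤ (K * ‖c z‖) ^ 2 := pow_le_pow_left₀ (norm_nonneg _) h 2
      _ = K ^ 2 * ‖c z‖ ^ 2 := by ring
  calc ∑ y ∈ periodBox (d := d) (M * N), ∑ α : Fin d, ‖gaugeDir W (dressW M W (bump2 M c)) y α‖ ^ 2
      = ∑ z ∈ periodBox (d := d) N, ∑ v ∈ periodBox (d := d) M, ∑ α : Fin d, ‖gaugeDir W (dressW M W (bump2 M c)) ((M : ℤ) • z + v) α‖ ^ 2 := by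
        rw [← sum_periodBox_blocks M N hM]
    _ ≤ ∑ z ∈ periodBox (d := d) N, ∑ _v ∈ periodBox (d := d) M, ∑ _α : Fin d, K ^ 2 * ‖c z‖ ^ 2 :=
        Finset.sum_le_sum fun z _ => Finset.sum_le_sum fun v hv => Finset.sum_le_sum fun α _ => hpt z hv α
    _ = (d : ℝ) * (M : ℝ) ^ d * K ^ 2 * ∑ z ∈ periodBox (d := d) N, ‖c z‖ ^ 2 := by
        rw [Finset.mul_sum]
        refine Finset.sum_congr rfl fun z _ => ?_
        rw [Finset.sum_const, Finset.sum_const, Finset.card_univ, Fintype.card_fin, card_periodBox, nsmul_eq_mul, nsmul_eq_mul]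
        push_cast
        ring

/-! ## §2 The covariant gradient of the squared-tent nested-mean fix -/

section Fix

variable {L : ℕ} (hL : 2 ≤ L) (j : ℕ) {W : Site d → Fin d → (Matrix n n ℂ)ˣ} {x : ℝ}
  (hWu : IsUnitaryCfg W) (hx : 0 ≤ x) (hsm : LevelSmall d L j x) (hWx : SmallField W x)
  (hE : 4 * (d : ℝ) ^ 2 * ((L : ℝ) ^ (j + 1) - 1) ^ 2 * x + 16 * d * loopRad d L ((prop1Radius d L)^[j] x) ≤ 1 / 2)

/-- **THE `ℓ²` GRADIENT OF THE FIX**: `Σ_{y∈periodBox(M·N)} Σ_α ‖gaugeDir W (sfixW … θ′) y α‖² ≤ d·M^d·(2∕M + 2(d−1)(M−1)x)²·(2∕tentMean2)²·Σ_{z∈periodBox N} ‖θ′ z‖²` (`M = L^{j+1}`):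
§1 with `c = sfixCoef θ′` and `‖sfixCoef θ′ z‖ ≤ (2∕tentMean2)·‖θ′ z‖`. [folklore] -/
theorem sum_normSq_gaugeDir_sfixW_le (N : ℕ) (θ' : Site d → Matrix n n ℂ) :
    ∑ y ∈ periodBox (d := d) (L ^ (j + 1) * N), ∑ α : Fin d, ‖gaugeDir W (sfixW hL j hWu hx hsm hWx hE θ') y α‖ ^ 2
      ≤ (d : ℝ) * ((L : ℝ) ^ (j + 1)) ^ d * (2 / ((L : ℝ) ^ (j + 1)) + 2 * (((d : ℝ) - 1) * (((L : ℝ) ^ (j + 1)) - 1) * x)) ^ 2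
          * (2 / tentMean2 d (L ^ (j + 1))) ^ 2 * ∑ z ∈ periodBox (d := d) N, ‖θ' z‖ ^ 2 := by
  have hL1 : 1 ≤ L := by omega
  have hM1 : 1 ≤ L ^ (j + 1) := Nat.one_le_pow _ _ hL1
  have hM2 : 2 ≤ L ^ (j + 1) := le_trans hL (Nat.le_self_pow (Nat.succ_ne_zero j) L)
  have hMR : (((L ^ (j + 1) : ℕ) : ℝ)) = (L : ℝ) ^ (j + 1) := by push_cast; ring
  have ht := tentMean2_pos hM2 d
  have h1 := sum_normSq_gaugeDir_dressW_bump2_le hM1 N hWu hx hWx (sfixCoef hL j hWu hx hsm hWx hE θ')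
  rw [hMR] at h1
  have h2 : ∑ z ∈ periodBox (d := d) N, ‖sfixCoef hL j hWu hx hsm hWx hE θ' z‖ ^ 2
      ≤ (2 / tentMean2 d (L ^ (j + 1))) ^ 2 * ∑ z ∈ periodBox (d := d) N, ‖θ' z‖ ^ 2 := by
    rw [Finset.mul_sum]
    refine Finset.sum_le_sum fun z _ => ?_
    have h := norm_sfixCoef_le hL j hWu hx hsm hWx hE θ' z
    calc ‖sfixCoef hL j hWu hx hsm hWx hE θ' z‖ ^ 2 ≤ (2 / tentMean2 d (L ^ (j + 1)) * ‖θ' z‖) ^ 2 := pow_le_pow_left₀ (norm_nonneg _) h 2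
      _ = (2 / tentMean2 d (L ^ (j + 1))) ^ 2 * ‖θ' z‖ ^ 2 := by ring
  have hC : 0 ≤ (d : ℝ) * ((L : ℝ) ^ (j + 1)) ^ d * (2 / ((L : ℝ) ^ (j + 1)) + 2 * (((d : ℝ) - 1) * (((L : ℝ) ^ (j + 1)) - 1) * x)) ^ 2 := by positivity
  unfold sfixW
  calc ∑ y ∈ periodBox (d := d) (L ^ (j + 1) * N), ∑ α : Fin d,
        ‖gaugeDir W (dressW (L ^ (j + 1)) W (bump2 (L ^ (j + 1)) (sfixCoef hL j hWu hx hsm hWx hE θ'))) y α‖ ^ 2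
      ≤ (d : ℝ) * ((L : ℝ) ^ (j + 1)) ^ d * (2 / ((L : ℝ) ^ (j + 1)) + 2 * (((d : ℝ) - 1) * (((L : ℝ) ^ (j + 1)) - 1) * x)) ^ 2
          * ∑ z ∈ periodBox (d := d) N, ‖sfixCoef hL j hWu hx hsm hWx hE θ' z‖ ^ 2 := h1
    _ ≤ (d : ℝ) * ((L : ℝ) ^ (j + 1)) ^ d * (2 / ((L : ℝ) ^ (j + 1)) + 2 * (((d : ℝ) - 1) * (((L : ℝ) ^ (j + 1)) - 1) * x)) ^ 2
          * ((2 / tentMean2 d (L ^ (j + 1))) ^ 2 * ∑ z ∈ periodBox (d := d) N, ‖θ' z‖ ^ 2) := mul_le_mul_of_nonneg_left h2 hC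
    _ = _ := by ring

end Fix

end

end Summit.QuantumFields.BalabanUV.T4Continuum.NE7SquaredBumpGradient
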